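import Mathlib.Analysis.InnerProductSpace.Spectrum
import Mathlib.Analysis.InnerProductSpace.l2Space
import Mathlib.Analysis.InnerProductSpace.Adjoint
import Mathlib.Analysis.Normed.Operator.Compact.Basic
import Mathlib.Algebra.Order.Archimedean.Real.Basic
import Literature.Analysis.OperatorTheory.CompactSelfAdjointEigenbasis
import Literature.Analysis.OperatorTheory.TempleInequality
import Literature.Analysis.OperatorTheory.CompactEmbeddingFormSpectrum
import HarnessLib

/-!
# The bottom of the Rayleigh quotient of a compact self-adjoint operator is attained

Topic `Literature/Analysis/OperatorTheory` (next to `CompactSelfAdjointEigenbasis.lean`, `TempleInequality.lean`).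
Theorems only (no definition, no named fact, no instance).

Let `T` be a compact self-adjoint operator on a Hilbert space `E` over `𝕜 = ℝ` or `ℂ` and let
`m = inf {Re ⟪x, T x⟫ : ‖x‖ = 1}` be the bottom of its numerical range.  If `m < 0` then

* `m` is an eigenvalue of `T`: it is ATTAINED, `Re ⟪x, T x⟫ = m` for some unit vector `x`
  (indeed `m = min λ_i` is the smallest eigenvalue — the negative eigenvalues of a compact operator
  have finite multiplicity and accumulate only at `0`);
* every unit minimiser is an eigenvector: `‖x‖ = 1`, `Re ⟪x, T x⟫ = m ⟹ T x = m x`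

(Reed–Simon I, Thm. VI.16 and the min–max principle, Reed–Simon IV, Thm. XIII.1).  We phrase the
infimum through `IsGLB`, so that consumers may present the Rayleigh set in their own way, and we give the
statement for the compression of `T` to a closed invariant subspace (`…_of_invariant`) and to the fixed
space `{x | P x = x}` of an operator `P` commuting with `T` (`…_of_commute`; typically `P` is a spectral
or symmetry projection), which is the form used for symmetry sectors of integral operators.

Proof: expand in a Hilbert basis of eigenvectors (`exists_hilbertBasis_eigenvectors_of_isSelfAdjoint`),
`Re ⟪x, T x⟫ = Σ λ_i |⟪e_i, x⟫|²` (`hasSum_eigen_norm_sq`); by Ritz some `λ_i < m/2`, and only finitely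
many `λ_i` have `|λ_i| ≥ -m/2` (`tendsto_norm_eigenvalue_cofinite`), so `λ₁ = min λ_i` exists; it is a
lower bound of the Rayleigh quotient and a value of it, hence `λ₁ = m`; and for a minimiser
`Σ (λ_i - m) |⟪e_i, x⟫|² = 0` forces `⟪e_i, T x - m x⟫ = (λ_i - m) ⟪e_i, x⟫ = 0` for all `i`.

## References

* M. Reed, B. Simon, *Methods of Modern Mathematical Physics I: Functional Analysis* (1980),
  Thm. VI.16 (Hilbert–Schmidt theorem). [ReedSimonI1980]
* M. Reed, B. Simon, *Methods of Modern Mathematical Physics IV: Analysis of Operators* (1978),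
  Thm. XIII.1 (min–max). [ReedSimonIV1978]
-/

noncomputable section

open scoped InnerProductSpace ComplexConjugate
open Filter _root_.Topology

namespace Literature.Analysis.OperatorTheory

variable {𝕜 E : Type*} [RCLike 𝕜] [NormedAddCommGroup E] [InnerProductSpace 𝕜 E]

/-- **A vector with vanishing coefficients in a Hilbert basis is zero.** [folklore] -/
theorem eq_zero_of_forall_inner_hilbertBasis_eq_zero {ι : Type*} (b : HilbertBasis ι 𝕜 E) {y : E}
    (hy : ∀ i, ⟪b i, y⟫_𝕜 = 0) : y = 0 := by
  have h := hasSum_norm_inner_sq b y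
  simp only [hy, norm_zero, ne_eq, OfNat.ofNat_ne_zero, not_false_eq_true, zero_pow] at h
  have h0 : ‖y‖ ^ 2 = 0 := h.unique hasSum_zero ▸ rfl
  exact norm_eq_zero.1 (pow_eq_zero_iff two_ne_zero |>.1 h0)

variable [CompleteSpace E]

/-- **The negative bottom of the numerical range of a compact self-adjoint operator is an attained
eigenvalue.** If `T` is compact and self-adjoint on a Hilbert space and `m < 0` is the greatest lower
bound of `{Re ⟪x, T x⟫ : ‖x‖ = 1}`, then `Re ⟪x, T x⟫ = m` for some unit vector `x`, and every unit
vector with `Re ⟪x, T x⟫ = m` satisfies `T x = m x` (Reed–Simon I, Thm. VI.16 with the min–max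
characterisation of the lowest eigenvalue). [cite: ReedSimonI1980, Thm. VI.16] -/
theorem exists_rayleigh_eq_of_isGLB_of_neg {T : E →L[𝕜] E} (hT : IsSelfAdjoint T)
    (hTc : IsCompactOperator T) {m : ℝ}
    (hm : IsGLB {r : ℝ | ∃ x : E, ‖x‖ = 1 ∧ RCLike.re ⟪x, T x⟫_𝕜 = r} m) (hneg : m < 0) :
    (∃ x : E, ‖x‖ = 1 ∧ RCLike.re ⟪x, T x⟫_𝕜 = m) ∧
      ∀ x : E, ‖x‖ = 1 → RCLike.re ⟪x, T x⟫_𝕜 = m → T x = (m : 𝕜) • x := by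
  classical
  obtain ⟨s, b, κ, -, hb⟩ := exists_hilbertBasis_eigenvectors_of_isSelfAdjoint hTc hT
  have hsym : ∀ x y : E, ⟪T x, y⟫_𝕜 = ⟪x, T y⟫_𝕜 := fun x y => hT.isSymmetric x y
  -- a unit vector strictly below `m / 2`, and (Ritz) an eigenvalue below it
  obtain ⟨r₀, ⟨x₀, hx₀, rfl⟩, -, hr₀⟩ := hm.exists_between (show m < m / 2 by linarith)
  obtain ⟨i₀, -, hi₀⟩ := exists_eigenvalue_le_rayleigh b hsym hb hx₀
  -- only finitely many eigenvalues have modulus `≥ -m/2`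
  have hε : 0 < -m / 2 := by linarith
  have htend := tendsto_norm_eigenvalue_cofinite hTc b.orthonormal (μ := fun i => ((κ i : ℝ) : 𝕜)) hb
  have hfin : {i : s | ¬‖((κ i : ℝ) : 𝕜)‖ < -m / 2}.Finite :=
    eventually_cofinite.1 (htend (Iio_mem_nhds hε))
  set F : Finset s := hfin.toFinset with hF
  have hmemF : ∀ i, i ∈ F ↔ -m / 2 ≤ |κ i| := fun i => by
    rw [hF, Set.Finite.mem_toFinset, Set.mem_setOf_eq, RCLike.norm_ofReal, not_lt]
  have hi₀F : i₀ ∈ F := by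
    rw [hmemF]
    have : κ i₀ < m / 2 := hi₀.trans_lt hr₀
    rw [abs_of_neg (by linarith)]
    linarith
  obtain ⟨i₁, hi₁F, hi₁⟩ := F.exists_min_image κ ⟨i₀, hi₀F⟩
  -- `κ i₁` is the smallest eigenvalue
  have hall : ∀ i, κ i₁ ≤ κ i := fun i => by
    by_cases hi : i ∈ F
    · exact hi₁ i hi
    · rw [hmemF, not_le] at hi
      have h1 : κ i₁ ≤ κ i₀ := hi₁ i₀ hi₀F
      have h2 : κ i₀ < m / 2 := hi₀.trans_lt hr₀
      have h3 : -(-m / 2) < κ i := (abs_lt.1 hi).1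
      linarith
  -- hence a lower bound of the Rayleigh quotient ...
  have hlow : ∀ x : E, κ i₁ * ‖x‖ ^ 2 ≤ RCLike.re ⟪x, T x⟫_𝕜 := fun x =>
    hasSum_le (fun i => mul_le_mul_of_nonneg_right (hall i) (sq_nonneg _))
      ((hasSum_norm_inner_sq b x).mul_left (κ i₁)) (hasSum_eigen_norm_sq b hsym hb x)
  have hle : κ i₁ ≤ m := hm.2 (by
    rintro r ⟨x, hx, rfl⟩
    have := hlow x
    rwa [hx, one_pow, mul_one] at this)
  -- ... and a value of it
  have hunit : ‖b i₁‖ = 1 := b.orthonormal.norm_eq_one i₁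
  have hval : RCLike.re ⟪b i₁, T (b i₁)⟫_𝕜 = κ i₁ := (eigenvalue_eq_re_inner b hb i₁).symm
  have hge : m ≤ κ i₁ := hm.1 ⟨b i₁, hunit, hval⟩
  have hm₁ : κ i₁ = m := le_antisymm hle hge
  refine ⟨⟨b i₁, hunit, hval.trans hm₁⟩, fun x hx hxm => ?_⟩
  -- a minimiser: `Σ (κ i - m) |⟪b i, x⟫|² = 0` with nonnegative terms
  have hsum : HasSum (fun i => (κ i - m) * ‖⟪b i, x⟫_𝕜‖ ^ 2) 0 := by
    have h := (hasSum_eigen_norm_sq b hsym hb x).sub ((hasSum_norm_inner_sq b x).mul_left m)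
    rw [hxm, hx, one_pow, mul_one, sub_self] at h
    have hfun : (fun i => (κ i - m) * ‖⟪b i, x⟫_𝕜‖ ^ 2) =
        fun i => κ i * ‖⟪b i, x⟫_𝕜‖ ^ 2 - m * ‖⟪b i, x⟫_𝕜‖ ^ 2 := by
      funext i; ring
    rw [hfun]; exact h
  have hzero := (hasSum_zero_iff_of_nonneg fun i =>
    mul_nonneg (sub_nonneg.2 (hm₁ ▸ hall i)) (sq_nonneg _)).1 hsum
  -- so all coefficients of `T x - m x` vanish
  rw [← sub_eq_zero]
  refine eq_zero_of_forall_inner_hilbertBasis_eq_zero b fun i => ?_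
  have hi := congr_fun hzero i
  simp only [Pi.zero_apply, mul_eq_zero, pow_eq_zero_iff two_ne_zero, norm_eq_zero] at hi
  rw [inner_sub_right, inner_smul_right, inner_hilbertBasis_eigen b hsym hb x i, ← sub_mul]
  rcases hi with hi | hi
  · rw [show ((κ i : ℝ) : 𝕜) - (m : 𝕜) = ((κ i - m : ℝ) : 𝕜) by push_cast; ring, hi]; simp
  · rw [hi, mul_zero]

/-- **Bottom of a compact self-adjoint operator on a closed invariant subspace.** If `T` is compact and
self-adjoint, `V` a closed `T`-invariant subspace, and `m < 0` is the greatest lower bound of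
`{Re ⟪x, T x⟫ : x ∈ V, ‖x‖ = 1}`, then `m` is attained on a unit vector of `V` and every unit minimiser
`x ∈ V` satisfies `T x = m x` (the previous statement for the compression of `T` to `V`, which is again
compact and self-adjoint). [cite: ReedSimonI1980, Thm. VI.16] -/
theorem exists_rayleigh_eq_of_isGLB_of_neg_of_invariant {T : E →L[𝕜] E} (hT : IsSelfAdjoint T)
    (hTc : IsCompactOperator T) {V : Submodule 𝕜 E} (hV : IsClosed (V : Set E))
    (hTV : ∀ v ∈ V, T v ∈ V) {m : ℝ}
    (hm : IsGLB {r : ℝ | ∃ x ∈ V, ‖x‖ = 1 ∧ RCLike.re ⟪x, T x⟫_𝕜 = r} m) (hneg : m < 0) :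
    (∃ x ∈ V, ‖x‖ = 1 ∧ RCLike.re ⟪x, T x⟫_𝕜 = m) ∧
      ∀ x ∈ V, ‖x‖ = 1 → RCLike.re ⟪x, T x⟫_𝕜 = m → T x = (m : 𝕜) • x := by
  haveI : CompleteSpace V := hV.completeSpace_coe
  set S : V →L[𝕜] V := (T.comp V.subtypeL).codRestrict V (fun v => hTV v v.2) with hS
  have hSv : ∀ v : V, (S v : E) = T v := fun v => rfl
  have hSc : IsCompactOperator S :=
    (hTc.comp_clm V.subtypeL).codRestrict (V := V) (fun v => hTV v v.2) hV
  have hSsym : ∀ v w : V, ⟪S v, w⟫_𝕜 = ⟪v, S w⟫_𝕜 := fun v w => by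
    rw [Submodule.coe_inner, Submodule.coe_inner, hSv, hSv]
    exact hT.isSymmetric v w
  have hSsa : IsSelfAdjoint S := ContinuousLinearMap.isSelfAdjoint_iff_isSymmetric.2 hSsym
  have hset : {r : ℝ | ∃ x : V, ‖x‖ = 1 ∧ RCLike.re ⟪x, S x⟫_𝕜 = r} =
      {r : ℝ | ∃ x ∈ V, ‖x‖ = 1 ∧ RCLike.re ⟪x, T x⟫_𝕜 = r} := by
    ext r
    constructor
    · rintro ⟨x, hx, rfl⟩
      exact ⟨x, x.2, by rw [← Submodule.coe_norm]; exact hx, by rw [Submodule.coe_inner, hSv]⟩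
    · rintro ⟨x, hxV, hx, rfl⟩
      exact ⟨⟨x, hxV⟩, by rw [Submodule.coe_norm]; exact hx, by rw [Submodule.coe_inner, hSv]⟩
  rw [← hset] at hm
  obtain ⟨⟨x, hx, hxm⟩, heig⟩ := exists_rayleigh_eq_of_isGLB_of_neg hSsa hSc hm hneg
  refine ⟨⟨x, x.2, by rw [← Submodule.coe_norm]; exact hx, by rw [← hSv, ← Submodule.coe_inner]; exact hxm⟩,
    fun y hyV hy hym => ?_⟩
  have h := heig ⟨y, hyV⟩ (by rw [Submodule.coe_norm]; exact hy)
    (by rw [Submodule.coe_inner, hSv]; exact hym)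
  have h' := congrArg Subtype.val h
  rw [hSv, Submodule.coe_smul] at h'
  exact h'

/-- **Bottom of a compact self-adjoint operator in a symmetry sector.** If `T` is compact and
self-adjoint, `P` a bounded operator commuting with `T` (e.g. the orthogonal projection onto a
symmetry sector), and `m < 0` is the greatest lower bound of `{Re ⟪x, T x⟫ : P x = x, ‖x‖ = 1}`, then
`m` is attained on a unit vector fixed by `P`, and every unit minimiser fixed by `P` satisfies
`T x = m x` (apply the previous statement to the closed invariant subspace `ker (1 - P)`).
[cite: ReedSimonI1980, Thm. VI.16] -/
theorem exists_rayleigh_eq_of_isGLB_of_neg_of_commute {T P : E →L[𝕜] E} (hT : IsSelfAdjoint T)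
    (hTc : IsCompactOperator T) (hTP : T * P = P * T) {m : ℝ}
    (hm : IsGLB {r : ℝ | ∃ x : E, P x = x ∧ ‖x‖ = 1 ∧ RCLike.re ⟪x, T x⟫_𝕜 = r} m) (hneg : m < 0) :
    (∃ x : E, P x = x ∧ ‖x‖ = 1 ∧ RCLike.re ⟪x, T x⟫_𝕜 = m) ∧
      ∀ x : E, P x = x → ‖x‖ = 1 → RCLike.re ⟪x, T x⟫_𝕜 = m → T x = (m : 𝕜) • x := by
  set V : Submodule 𝕜 E := ((1 : E →L[𝕜] E) - P).ker with hVdef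
  have hmemV : ∀ x, x ∈ V ↔ P x = x := fun x => by
    rw [hVdef, LinearMap.mem_ker, ContinuousLinearMap.coe_coe, sub_apply, one_apply_eq_self, sub_eq_zero,
      eq_comm]
  have hV : IsClosed (V : Set E) := ContinuousLinearMap.isClosed_ker _
  have hTV : ∀ v ∈ V, T v ∈ V := fun v hv => by
    rw [hmemV] at hv ⊢
    have h := congrArg (fun f : E →L[𝕜] E => f v) hTP
    simp only [mul_apply_eq_comp] at h
    rw [hv] at h
    exact h.symm
  have hset : {r : ℝ | ∃ x ∈ V, ‖x‖ = 1 ∧ RCLike.re ⟪x, T x⟫_𝕜 = r} =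
      {r : ℝ | ∃ x : E, P x = x ∧ ‖x‖ = 1 ∧ RCLike.re ⟪x, T x⟫_𝕜 = r} := by
    simp only [hmemV]
  rw [← hset] at hm
  obtain ⟨⟨x, hxV, hx, hxm⟩, heig⟩ := exists_rayleigh_eq_of_isGLB_of_neg_of_invariant hT hTc hV hTV hm hneg
  exact ⟨⟨x, (hmemV x).1 hxV, hx, hxm⟩, fun y hy => heig y ((hmemV y).2 hy)⟩

/-- **Real-scalar form** of `exists_rayleigh_eq_of_isGLB_of_neg_of_commute` (no `re`, no coercion of the
eigenvalue): for `T` compact self-adjoint on a real Hilbert space commuting with `P`, a negative greatest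
lower bound `m` of `{⟪x, T x⟫ : P x = x, ‖x‖ = 1}` is attained, and every unit minimiser fixed by `P`
satisfies `T x = m • x`. [cite: ReedSimonI1980, Thm. VI.16] -/
theorem exists_rayleigh_eq_of_isGLB_of_neg_of_commute_real {F : Type*} [NormedAddCommGroup F]
    [InnerProductSpace ℝ F] [CompleteSpace F] {T P : F →L[ℝ] F} (hT : IsSelfAdjoint T)
    (hTc : IsCompactOperator T) (hTP : T * P = P * T) {m : ℝ}
    (hm : IsGLB {r : ℝ | ∃ x : F, P x = x ∧ ‖x‖ = 1 ∧ ⟪x, T x⟫_ℝ = r} m) (hneg : m < 0) :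
    (∃ x : F, P x = x ∧ ‖x‖ = 1 ∧ ⟪x, T x⟫_ℝ = m) ∧
      ∀ x : F, P x = x → ‖x‖ = 1 → ⟪x, T x⟫_ℝ = m → T x = m • x := by
  have h := exists_rayleigh_eq_of_isGLB_of_neg_of_commute (𝕜 := ℝ) hT hTc hTP (m := m)
    (by simpa only [RCLike.re_to_real] using hm) hneg
  simpa only [RCLike.re_to_real, RCLike.ofReal_real_eq_id, id_eq] using h

end Literature.Analysis.OperatorTheory

end
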